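import Summits.QuantumFields.YangMills.Theorems.ForcedResponseSkewnessFemtoEngineClusterPin
import Summits.QuantumFields.YangMills.Theorems.ForcedResponseSkewnessFemtoEngineHCCertificate
import HarnessLib

/-!
# Route `ForcedResponseSkewness`: the route certificate from the ENGINE and GAP-CLASS CLUSTERING in one unit (lead `ym-line-frs-p1` g7, 2026-08-28)

Helper file (`--supports stmt-QuantumFields-26871`, also serves 24275).  Composition of `FemtoEngine.femtoEngineSigR_of_engine_clustering`
(`…FemtoEngineClusterPin.lean`) with the landed certificate `FemtoEngine.nt_of_femtoEngine` (g6).  For every compact simple `G` and lattice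
representation `r`, ONE unit map `u → 0⁺` carrying
  (ENGINE)  `FemtoEngineAt G r u` — E0′ `FBL6Osc`, E-sym `CentredOscLaw`, E-log `CentredFemtoLog` on the centred femto cubes along `u`, arbitrary exteriors
            (Bałaban-class small-field renormalisation group with prescribed exterior; not in print), and
  (GAP CLASS)  torus clustering in the unit `u` — bounded continuous cylinder observables whose supports are torus-separated by `n` in one coordinate
            have covariance `≤ K‖P‖‖Q‖e^{−m·u(β)·n}` on all large tori at all large `β` (the hypothesis `hCl` of `Far.far_ceiling_of_fbl_clustering`, which
            already conditions the residual's far-field clause; IR = the lattice mass gap in the unit `u`, NOT proved),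
implies both cruxes and, with the declared residual `FloorWithScalingLimits` (24873), the leaf `NT`.

* `nt_of_engine_clustering` (+ `responseLocalisation_of_engine_clustering`, `runningCouplingCeiling_of_engine_clustering`).

So the route proves, kernel-checked:  NT  ⇐  residual (clause (i) for the shrinking family + E′ limits + far-field ceiling)  ∧  ENGINE in one unit
∧  gap-class clustering in that unit.  HONEST LABEL: conditional compositions (audit: `proof.conditional`, credits nothing); the engine laws, the clustering
(= the gap), the residual, the cruxes 26871/24275, `NT` and the Yang–Mills mass gap are NOT proved; leaf R2a, not the summit Statement.
-/

set_option autoImplicit false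

noncomputable section

namespace Summit.QuantumFields.YangMills.Cruxes.ResponseLocalisation.FemtoEngine

open MeasureTheory Filter Topology
open Literature.MathematicalPhysics.QuantumFieldTheory Literature.MathematicalPhysics.QuantumLattice
open Literature.Probability.LatticeModels
open Summit.QuantumFields.YangMills.Cruxes.OSLegsFromFemtoAndGap.DlrCollarTransfer
open Summit.QuantumFields.YangMills.Cruxes.ResponseLocalisation.Birth
open Summit.QuantumFields.YangMills.Theses.ForcedResponseSkewness

/-- **The route certificate from the engine and gap-class clustering in one unit per `(G, r)`** (plus the declared residual):
the leaf `NT`.  Conditional; nothing of the hypotheses is proved. [folklore] -/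
theorem nt_of_engine_clustering
    (h : ∀ (G : Type) [Group G] [TopologicalSpace G] [IsTopologicalGroup G] [CompactSpace G],
      IsCompactSimpleLieGroup G →
      letI : MeasurableSpace G := borel G
      haveI : BorelSpace G := ⟨rfl⟩
      ∀ (r : LatticeRep G), ∃ u : ℝ → ℝ, (∀ β, 0 < u β) ∧ Filter.Tendsto u Filter.atTop (nhds 0) ∧
        FemtoEngineAt G r u ∧
        (∃ m K β₀ Λ₀ : ℝ, 0 < m ∧ 0 ≤ K ∧ ∀ β : ℝ, β₀ ≤ β → ∀ L : ℕ, Λ₀ ≤ u β * L →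
          ∀ (P Q : LGConfig 4 G → ℝ) (SP SQ : Finset (Literature.MathematicalPhysics.QuantumLattice.ZdEdge 4))
            (CP CQ : ℝ), Continuous P → Continuous Q → IsCylinder P SP → IsCylinder Q SQ →
            (∀ U, |P U| ≤ CP) → (∀ U, |Q U| ≤ CQ) → ∀ (k : Fin 4) (n : ℕ),
            (∀ e ∈ SP, ∀ e' ∈ SQ, (n : ℤ) ≤ |((((e.1 k - e'.1 k : ℤ) : ZMod (2 * L + 1))).valMinAbs : ℤ)|) →
            |torusE G r β L (fun U => P U * Q U) - torusE G r β L P * torusE G r β L Q| ≤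
              K * CP * CQ * Real.exp (-(m * u β * n))))
    (hRes : FloorWithScalingLimits) :
    Summit.QuantumFields.YangMills.Theses.BalabanLadder.NT :=
  nt_of_femtoEngine (femtoEngineSigR_of_engine_clustering h) hRes

/-- **Deciding crux from the engine and gap-class clustering in one unit.** [folklore] -/
theorem responseLocalisation_of_engine_clustering
    (h : ∀ (G : Type) [Group G] [TopologicalSpace G] [IsTopologicalGroup G] [CompactSpace G],
      IsCompactSimpleLieGroup G →
      letI : MeasurableSpace G := borel G
      haveI : BorelSpace G := ⟨rfl⟩
      ∀ (r : LatticeRep G), ∃ u : ℝ → ℝ, (∀ β, 0 < u β) ∧ Filter.Tendsto u Filter.atTop (nhds 0) ∧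
        FemtoEngineAt G r u ∧
        (∃ m K β₀ Λ₀ : ℝ, 0 < m ∧ 0 ≤ K ∧ ∀ β : ℝ, β₀ ≤ β → ∀ L : ℕ, Λ₀ ≤ u β * L →
          ∀ (P Q : LGConfig 4 G → ℝ) (SP SQ : Finset (Literature.MathematicalPhysics.QuantumLattice.ZdEdge 4))
            (CP CQ : ℝ), Continuous P → Continuous Q → IsCylinder P SP → IsCylinder Q SQ →
            (∀ U, |P U| ≤ CP) → (∀ U, |Q U| ≤ CQ) → ∀ (k : Fin 4) (n : ℕ),
            (∀ e ∈ SP, ∀ e' ∈ SQ, (n : ℤ) ≤ |((((e.1 k - e'.1 k : ℤ) : ZMod (2 * L + 1))).valMinAbs : ℤ)|) →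
            |torusE G r β L (fun U => P U * Q U) - torusE G r β L P * torusE G r β L Q| ≤
              K * CP * CQ * Real.exp (-(m * u β * n)))) :
    ResponseLocalisation :=
  responseLocalisation_of_femtoEngine (femtoEngineSigR_of_engine_clustering h)

/-- **Crux 24275 from the engine and gap-class clustering in one unit.** [folklore] -/
theorem runningCouplingCeiling_of_engine_clustering
    (h : ∀ (G : Type) [Group G] [TopologicalSpace G] [IsTopologicalGroup G] [CompactSpace G],
      IsCompactSimpleLieGroup G →
      letI : MeasurableSpace G := borel G
      haveI : BorelSpace G := ⟨rfl⟩
      ∀ (r : LatticeRep G), ∃ u : ℝ → ℝ, (∀ β, 0 < u β) ∧ Filter.Tendsto u Filter.atTop (nhds 0) ∧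
        FemtoEngineAt G r u ∧
        (∃ m K β₀ Λ₀ : ℝ, 0 < m ∧ 0 ≤ K ∧ ∀ β : ℝ, β₀ ≤ β → ∀ L : ℕ, Λ₀ ≤ u β * L →
          ∀ (P Q : LGConfig 4 G → ℝ) (SP SQ : Finset (Literature.MathematicalPhysics.QuantumLattice.ZdEdge 4))
            (CP CQ : ℝ), Continuous P → Continuous Q → IsCylinder P SP → IsCylinder Q SQ →
            (∀ U, |P U| ≤ CP) → (∀ U, |Q U| ≤ CQ) → ∀ (k : Fin 4) (n : ℕ),
            (∀ e ∈ SP, ∀ e' ∈ SQ, (n : ℤ) ≤ |((((e.1 k - e'.1 k : ℤ) : ZMod (2 * L + 1))).valMinAbs : ℤ)|) →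
            |torusE G r β L (fun U => P U * Q U) - torusE G r β L P * torusE G r β L Q| ≤
              K * CP * CQ * Real.exp (-(m * u β * n)))) :
    RunningCouplingCeiling :=
  runningCouplingCeiling_of_femtoEngine (femtoEngineSigR_of_engine_clustering h)

end Summit.QuantumFields.YangMills.Cruxes.ResponseLocalisation.FemtoEngine

end
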